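import Summits.QuantumFields.YangMills.Theorems.UnitScaleTiltFluctuationComparisonRegPrFibreLocalInverse
import Literature.MathematicalPhysics.QuantumFieldTheory.Balaban1983to89.BlockAveragingEMLHaarAC

/-!
# Route `UnitScaleTilt` — crux K1bR-pr `FluctuationComparisonRegPr` (stmt-QuantumFields-19201), stub `stub_oneStepSmallLift`
# (W7 line), step 2: THE MIDDLE-BOND REPAIR — «EXACTNESS IS FREE» FOR THE (0.4)/EML BLOCK AVERAGING ON `SU(2)`
# (support file `--supports stmt-QuantumFields-19201`)

Cell `ym3-torus` (rung R3), seat `ym3-torus-p2` gen 8.  The registered stub `stub_oneStepSmallLift` asks for EXACT one-step lifts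
`blockAvg ℰp U = V` with a gain `κ√L ≤ 1` on the plaquette sizes.  This file removes the exactness from the problem: by FACT (A)/(B) of
`BlockAveragingHaarAC` the coarse bond variable `Ū(c)` depends on the PRIVATE central crossing bond `β(c)` through the one-variable
fibre map `W ↦ exp(Σ_k |I|⁻¹ log(h_k W*))·W` (`W = pre·U(β c)·post`) and on no other central bond (`IsLocal`), so the coarse bonds
DECOUPLE once all non-central bonds are frozen, and each equation `Ū(c) = V(c)` is solved separately by the uniform local inverse of
`…FibreLocalInverse` near the degenerate set (all loop variables small):

* §1 `rhoU n₀`, `rhoU_spec`: ONE radius serving every off-central index count `m < n₀ = |I|` (weights `|I|⁻¹`), with the Lipschitz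
  constant `2n₀` and unit solutions;
* §2 the `SU(2) ↔ ℍ` dictionary for the fibre map (`su2Quat_fibreCore`: on the guard `su2Quat (ℰp.avg (fibreFamily W)·W) = kf a c (su2Quat W)`);
* §3 `exists_fibreMap_eq` (one bond) and **`exists_exact_repair`** (all bonds): if every (0.4) loop variable of `U⋆` is within
  `rhoU |I|` of `1` and `‖Ū⋆(c) − V(c)‖ ≤ rhoU |I| / (2|I|)` for all `c`, there is `U`, equal to `U⋆` off the central bonds, with
  `avgFun ℰp U = V` EXACTLY and `‖U(β c) − U⋆(β c)‖ ≤ 2|I|·‖Ū⋆(c) − V(c)‖`.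

The plaquette bookkeeping and the reduction `OneStepSmallLift ⇐ approximate lift` are in the sibling file `…ApproxLift`.
Elementary; nothing of Bałaban's is asserted ([folklore] calculus about the published formula (0.4) p. 253 of [Balaban1987RG1]).
-/

noncomputable section

open NormedSpace Set Metric Function Filter Topology
open scoped RealInnerProductSpace Quaternion NNReal Matrix.Norms.L2Operator

namespace Summit.QuantumFields.YangMills.Theorems.MiddleBondRepair

open Literature.MathematicalPhysics.QuantumFieldTheory.Balaban1983to89
open Literature.MathematicalPhysics.QuantumFieldTheory.Balaban1983to89.T4EMLFibreAC
open Literature.MathematicalPhysics.QuantumFieldTheory.Balaban1983to89.T4QuatExpLog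
open Literature.MathematicalPhysics.QuantumFieldTheory.Balaban1983to89.T4Continuum
open Literature.MathematicalPhysics.QuantumFieldTheory.Balaban1983to89.AveragingRT
open Literature.MathematicalPhysics.QuantumFieldTheory.Balaban1983to89.BlockAveraging
open Literature.MathematicalPhysics.QuantumFieldTheory.Balaban1983to89.BlockAveragingHaarAC
open Literature.MathematicalPhysics.QuantumFieldTheory.Balaban1983to89.BlockAveragingEMLHaarAC
open Literature.MathematicalPhysics.QuantumFieldTheory.Balaban1983to89.ExpMeanLog
open Literature.MathematicalPhysics.QuantumLattice (quatMatrix quatMatrix_mul quatMatrix_one quatMatrix_smul su2Quat norm_su2Quat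
  quatToSU2 coe_quatToSU2_of_norm_eq_one quatToSU2_su2Quat quatMatrix_su2Quat)
open Literature.Geometry.GaugeTheory (quatMatrix_star)
open T4HaarSU2Translate (su2Quat_quatToSU2 su2Quat_mul su2Quat_one su2Quat_eq_of_coe_eq)
open Summit.QuantumFields.YangMills.Theorems.FibreLocalInverse

/-! ## §1 One radius for every index count below `n₀` -/

section Uniform

/-- The SOLVABILITY CONCLUSION at index count `m`, total count `n₀` (weights `n₀⁻¹`) and radius `ρ`: unit parameters `a_i` within
`ρ` of a unit base point `u⋆` and a unit target within `ρ/(2n₀)` of `kf a c u⋆` admit a UNIT solution `u` of `kf a c u = t` with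
`‖u − u⋆‖ ≤ 2n₀·‖t − kf a c u⋆‖`. -/
def UnifSolve (m n₀ : ℕ) (ρ : ℝ) : Prop :=
  ∀ a : Fin m → ℍ, (∀ i, ‖a i‖ = 1) → ∀ ustar : ℍ, ‖ustar‖ = 1 → (∀ i, ‖a i - ustar‖ ≤ ρ) →
    ∀ t : ℍ, ‖t‖ = 1 → ‖t - kf a (fun _ => ((n₀ : ℝ))⁻¹) ustar‖ ≤ ρ / (2 * n₀) →
      ∃ u : ℍ, ‖u‖ = 1 ∧ kf a (fun _ => ((n₀ : ℝ))⁻¹) u = t ∧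
        ‖u - ustar‖ ≤ 2 * n₀ * ‖t - kf a (fun _ => ((n₀ : ℝ))⁻¹) ustar‖

/-- `UnifSolve` is antitone in the radius. -/
theorem UnifSolve.mono {m n₀ : ℕ} {ρ ρ' : ℝ} (h : UnifSolve m n₀ ρ) (hρ : ρ' ≤ ρ) : UnifSolve m n₀ ρ' :=
  fun a ha ustar hu hau t ht htk => h a ha ustar hu (fun i => (hau i).trans hρ) t ht
    (htk.trans (div_le_div_of_nonneg_right hρ (by positivity)))

/-- `UnifSolve m n₀ ρ` holds for SOME `ρ > 0` whenever `m < n₀` — the uniform local inverse of `…FibreLocalInverse` at the weights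
`n₀⁻¹` (`s = m/n₀ ≤ 1 − n₀⁻¹`). -/
theorem exists_unifSolve {m n₀ : ℕ} (hm : m < n₀) : ∃ ρ : ℝ, 0 < ρ ∧ UnifSolve m n₀ ρ := by
  have hn₀ : (0 : ℝ) < n₀ := by exact_mod_cast (Nat.zero_le m).trans_lt hm
  set c : Fin m → ℝ := fun _ => ((n₀ : ℝ))⁻¹ with hc_def
  have hc : ∀ i, 0 ≤ c i := fun _ => inv_nonneg.mpr hn₀.le
  have hsum : ∑ i, c i = (m : ℝ) / n₀ := by
    rw [Finset.sum_const, Finset.card_univ, Fintype.card_fin, nsmul_eq_mul, div_eq_mul_inv]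
  have hs : ∑ i, c i < 1 := by
    rw [hsum, div_lt_one hn₀]; exact_mod_cast hm
  have h1s : ((n₀ : ℝ))⁻¹ ≤ 1 - ∑ i, c i := by
    rw [hsum]
    have : (m : ℝ) + 1 ≤ n₀ := by exact_mod_cast hm
    rw [inv_eq_one_div, one_sub_div hn₀.ne', div_le_div_iff_of_pos_right hn₀]
    linarith
  obtain ⟨ρ, hρ, hsol⟩ := exists_kf_eq_near c hc hs
  refine ⟨ρ, hρ, fun a ha ustar hu hau t ht htk => ?_⟩
  have htk' : ‖t - kf a c ustar‖ ≤ (1 - ∑ i, c i) / 2 * ρ := by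
    refine htk.trans ?_
    calc ρ / (2 * n₀) = ((n₀ : ℝ))⁻¹ / 2 * ρ := by field_simp
      _ ≤ (1 - ∑ i, c i) / 2 * ρ := by
        refine mul_le_mul_of_nonneg_right (div_le_div_of_nonneg_right h1s zero_le_two) hρ.le
  obtain ⟨u, hut, hud, hug⟩ := hsol a ustar hu hau t htk'
  refine ⟨u, norm_eq_one_of_kf_eq ha hc hug hut ht, hut, hud.trans ?_⟩
  refine mul_le_mul_of_nonneg_right ?_ (norm_nonneg _)
  have hpos : 0 < 1 - ∑ i, c i := by linarith
  rw [div_le_iff₀ hpos]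
  calc (2 : ℝ) = 2 * n₀ * ((n₀ : ℝ))⁻¹ := by field_simp
    _ ≤ 2 * n₀ * (1 - ∑ i, c i) := mul_le_mul_of_nonneg_left h1s (by positivity)

/-- **ONE RADIUS FOR ALL INDEX COUNTS BELOW `n₀`** (finite minimum), capped at `1/12`. -/
theorem exists_uniform (n₀ : ℕ) : ∃ ρ : ℝ, 0 < ρ ∧ ρ ≤ 1 / 12 ∧ ∀ m : ℕ, m < n₀ → UnifSolve m n₀ ρ := by
  suffices h : ∀ k : ℕ, ∃ ρ : ℝ, 0 < ρ ∧ ρ ≤ 1 / 12 ∧ ∀ m : ℕ, m < k → m < n₀ → UnifSolve m n₀ ρ by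
    obtain ⟨ρ, hρ, hρ', h⟩ := h n₀
    exact ⟨ρ, hρ, hρ', fun m hm => h m hm hm⟩
  intro k
  induction k with
  | zero => exact ⟨1 / 12, by norm_num, le_rfl, fun m hm => absurd hm (Nat.not_lt_zero m)⟩
  | succ k ih =>
    obtain ⟨ρ, hρ, hρ', h⟩ := ih
    by_cases hk : k < n₀
    · obtain ⟨ρk, hρk, hk'⟩ := exists_unifSolve hk
      refine ⟨min ρ ρk, lt_min hρ hρk, (min_le_left _ _).trans hρ', fun m hm hmn => ?_⟩
      rcases Nat.lt_succ_iff_lt_or_eq.mp hm with hlt | rfl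
      · exact (h m hlt hmn).mono (min_le_left _ _)
      · exact hk'.mono (min_le_right _ _)
    · refine ⟨ρ, hρ, hρ', fun m hm hmn => h m ?_ hmn⟩
      rcases Nat.lt_succ_iff_lt_or_eq.mp hm with hlt | rfl
      · exact hlt
      · exact absurd hmn hk

/-- **THE UNIFORM RADIUS** `rhoU n₀` (a function of the total index count only). -/
def rhoU (n₀ : ℕ) : ℝ := (exists_uniform n₀).choose

/-- `rhoU n₀ > 0`. -/
theorem rhoU_pos (n₀ : ℕ) : 0 < rhoU n₀ := (exists_uniform n₀).choose_spec.1

/-- `rhoU n₀ ≤ 1/12`. -/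
theorem rhoU_le (n₀ : ℕ) : rhoU n₀ ≤ 1 / 12 := (exists_uniform n₀).choose_spec.2.1

/-- The solvability conclusion at the uniform radius, for every `m < n₀`. -/
theorem rhoU_spec {m n₀ : ℕ} (hm : m < n₀) : UnifSolve m n₀ (rhoU n₀) := (exists_uniform n₀).choose_spec.2.2 m hm

end Uniform

/-! ## §2 The `SU(2) ↔ ℍ` dictionary for the fibre map -/

section Dictionary

/-- `su2Quat` turns inverses into `star` (unit quaternions). -/
theorem su2Quat_inv (W : Matrix.specialUnitaryGroup (Fin 2) ℂ) : su2Quat W⁻¹ = star (su2Quat W) := by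
  have h1 : su2Quat W⁻¹ * su2Quat W = 1 := by rw [← su2Quat_mul, inv_mul_cancel, su2Quat_one]
  calc su2Quat W⁻¹ = su2Quat W⁻¹ * (su2Quat W * star (su2Quat W)) := by
        rw [self_mul_star_of_norm_eq_one (norm_su2Quat W), mul_one]
    _ = star (su2Quat W) := by rw [← mul_assoc, h1, one_mul]

/-- Matrix distances are quaternion distances: `‖W − W′‖ = ‖su2Quat W − su2Quat W′‖` (`L²`-operator norm). -/
theorem norm_coe_sub_coe (W W' : Matrix.specialUnitaryGroup (Fin 2) ℂ) :
    ‖(W : Matrix (Fin 2) (Fin 2) ℂ) - (W' : Matrix (Fin 2) (Fin 2) ℂ)‖ = ‖su2Quat W - su2Quat W'‖ := by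
  rw [← quatMatrix_su2Quat W, ← quatMatrix_su2Quat W', ← quatMatrix_sub, norm_quatMatrix]

/-- `dist1 W = ‖su2Quat W − 1‖`. -/
theorem dist1_eq_norm_su2Quat (W : Matrix.specialUnitaryGroup (Fin 2) ℂ) : dist1 W = ‖su2Quat W - 1‖ := by
  rw [← norm_quatMatrix, quatMatrix_sub, quatMatrix_su2Quat, quatMatrix_one]; rfl

/-- `‖h − W‖ = ‖h W* − 1‖` in `ℍ` for a unit `W`. -/
theorem norm_sub_eq_norm_mul_star_sub_one {h w : ℍ} (hw : ‖w‖ = 1) : ‖h - w‖ = ‖h * star w - 1‖ := by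
  have : h * star w - 1 = (h - w) * star w := by rw [sub_mul, self_mul_star_of_norm_eq_one hw]
  rw [this, norm_mul, norm_star, hw, mul_one]

/-- The MATRIX DISTANCE on `SU(2)`: `‖W − W′‖` in the `L²`-operator norm of `M₂(ℂ)` (the cell's standing norm, `dist1 W = mdist W 1`). -/
def mdist (W W' : Matrix.specialUnitaryGroup (Fin 2) ℂ) : ℝ :=
  ‖(W : Matrix (Fin 2) (Fin 2) ℂ) - (W' : Matrix (Fin 2) (Fin 2) ℂ)‖

/-- `mdist` in the quaternion model. -/
theorem mdist_eq (W W' : Matrix.specialUnitaryGroup (Fin 2) ℂ) : mdist W W' = ‖su2Quat W - su2Quat W'‖ := norm_coe_sub_coe W W'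

/-- `mdist` is symmetric. -/
theorem mdist_comm (W W' : Matrix.specialUnitaryGroup (Fin 2) ℂ) : mdist W W' = mdist W' W := by
  rw [mdist_eq, mdist_eq, norm_sub_rev]

/-- `mdist W W = 0`. -/
theorem mdist_self (W : Matrix.specialUnitaryGroup (Fin 2) ℂ) : mdist W W = 0 := by
  rw [mdist_eq, sub_self, norm_zero]

/-- `0 ≤ mdist`. -/
theorem mdist_nonneg (W W' : Matrix.specialUnitaryGroup (Fin 2) ℂ) : 0 ≤ mdist W W' := norm_nonneg _

/-- Triangle inequality for `mdist`. -/
theorem mdist_triangle (W W' W'' : Matrix.specialUnitaryGroup (Fin 2) ℂ) : mdist W W'' ≤ mdist W W' + mdist W' W'' := by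
  rw [mdist_eq, mdist_eq, mdist_eq]
  calc ‖su2Quat W - su2Quat W''‖ = ‖(su2Quat W - su2Quat W') + (su2Quat W' - su2Quat W'')‖ := by rw [sub_add_sub_cancel]
    _ ≤ ‖su2Quat W - su2Quat W'‖ + ‖su2Quat W' - su2Quat W''‖ := norm_add_le _ _

/-- `dist1 W = mdist W 1`. -/
theorem dist1_eq_mdist (W : Matrix.specialUnitaryGroup (Fin 2) ℂ) : dist1 W = mdist W 1 := by
  rw [mdist_eq, su2Quat_one, dist1_eq_norm_su2Quat]

variable {P : Params} {j : ℕ}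

/-- **THE FIBRE MAP IN THE QUATERNION MODEL**: on the guard, `su2Quat (ℰp.avg (fibreFamily U c W) · W) = kf a c (su2Quat W)` with
`a_k = su2Quat h_k` the off-central open holonomies and all weights `|I|⁻¹` (the computation of `T4EMLFibreAC` §5, recorded as an
identity). -/
theorem su2Quat_fibreCore (U : GaugeField P j (Matrix.specialUnitaryGroup (Fin 2) ℂ)) (c : PBond P (j+1))
    {W : Matrix.specialUnitaryGroup (Fin 2) ℂ} (hW : W ∈ fibreGuard expMeanLogSU U c) :
    su2Quat (expMeanLogSU.avg (fibreFamily U c W) * W) =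
      kf (fun k => su2Quat (offHol U c k)) (fun _ => emlWeight P) (su2Quat W) := by
  apply su2Quat_eq_of_coe_eq
  have hu : ‖su2Quat W‖ = 1 := norm_su2Quat W
  have hgq : ∀ k, ‖su2Quat (offHol U c k) * star (su2Quat W) - 1‖ < 1 / 2 := fun k => by
    have := norm_offHol_mul_star_sub_one_lt U c hW k
    rw [← quatMatrix_su2Quat W, ← quatToSU2_su2Quat W, quatMatrix_su2Quat,
      coe_mul_star_coe_quatToSU2 (offHol U c k) hu, norm_quatMatrix_sub_one] at this
    exact this.trans (by norm_num)
  rw [coe_fibreCore_eq U c hW, kf, quatMatrix_mul, quatMatrix_exp, quatMatrix_su2Quat]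
  congr 2
  rw [Yf, T4HaarSU2Translate.quatMatrix_sum]
  refine Finset.sum_congr rfl fun k _ => ?_
  rw [quatMatrix_smul, quatMatrix_qlog ((hgq k).trans (by norm_num)), ← coe_mul_star_coe_quatToSU2 (offHol U c k) hu,
    quatToSU2_su2Quat]

end Dictionary

/-! ## §3 The one-bond solve and the exact repair of all central bonds -/

section Repair

variable {P : Params} {j : ℕ}

/-- `1/6 < δ` for the printed small-loop average on `SU(2)` (`δ = min (1/3) (π/2) = 1/3`). -/
theorem one_sixth_lt_delta : (1 : ℝ) / 6 < (expMeanLogSU (n := Fin 2)).δ := by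
  rw [expMeanLogSU_δ, Fintype.card_fin]
  refine lt_min (by norm_num) ?_
  have := Real.pi_gt_three
  rw [lt_div_iff₀ (by norm_num : (0 : ℝ) < (2 : ℕ))]
  push_cast
  linarith

/-- At the base point `W⋆ = U(c)` the W-coordinate family IS the family of (0.4) loop variables. -/
theorem fibreFamily_axialAvg (U : GaugeField P j (Matrix.specialUnitaryGroup (Fin 2) ℂ)) (c : PBond P (j+1)) :
    fibreFamily U c (axialAvg U c) = loopHol U c := by
  funext i
  by_cases h : IsCentral c i
  · rw [fibreFamily_of_isCentral U c _ i h, loopHol_eq_openHol_mul, openHol_of_isCentral U c i h, mul_inv_cancel]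
  · rw [fibreFamily_of_not_isCentral U c _ i h, loopHol_eq_openHol_mul]

/-- In the quaternion model an off-central W-coordinate variable reads `a_k ū` (`a_k = su2Quat h_k`, `u = su2Quat W`). -/
theorem su2Quat_fibreFamily_off (U : GaugeField P j (Matrix.specialUnitaryGroup (Fin 2) ℂ)) (c : PBond P (j+1))
    (W : Matrix.specialUnitaryGroup (Fin 2) ℂ) (i : Idx P) (h : ¬ IsCentral c i) :
    su2Quat (fibreFamily U c W i) = su2Quat (openHol U c i) * star (su2Quat W) := by
  rw [fibreFamily_of_not_isCentral U c W i h, su2Quat_mul, su2Quat_inv]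

/-- The enumerated off-central open holonomy at the label of an off-central index is that index's open holonomy. -/
theorem offHol_offEquiv (U : GaugeField P j (Matrix.specialUnitaryGroup (Fin 2) ℂ)) (c : PBond P (j+1)) (i : Idx P)
    (h : ¬ IsCentral c i) : offHol U c (offEquiv c ⟨i, h⟩) = openHol U c i := by
  rw [offHol, Equiv.symm_apply_apply]

/-- Conjugation invariance of matrix distances: `‖A W B − A W′ B‖ = ‖W − W′‖` on `SU(2)`. -/
theorem mdist_conj (A B W W' : Matrix.specialUnitaryGroup (Fin 2) ℂ) : mdist (A * W * B) (A * W' * B) = mdist W W' := by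
  rw [mdist_eq, mdist_eq, su2Quat_mul, su2Quat_mul, su2Quat_mul, su2Quat_mul, ← sub_mul, ← mul_sub,
    norm_mul, norm_mul, norm_su2Quat, norm_su2Quat, one_mul, mul_one]

/-- The block average at `c` is the fibre map at the base point `W⋆ = U(c)`. -/
theorem avgFun_eq_fibreMap_axialAvg [DecidableEq (PBond P j)] (hj : j + 1 ≤ P.m + P.K) (ℰ : LoopAverage (Matrix.specialUnitaryGroup (Fin 2) ℂ))
    (U : GaugeField P j (Matrix.specialUnitaryGroup (Fin 2) ℂ)) (c : PBond P (j+1)) :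
    avgFun ℰ U c = fibreMap ℰ U c (axialAvg U c) := by
  have h := avgFun_update_centralBond_self hj ℰ U c (U (centralBond c))
  rwa [Function.update_eq_self, ← axialAvg_eq_pre_mul_mul_post] at h

/-- **THE ONE-BOND SOLVE.**  If every (0.4) loop variable of `U` at `c` is within `ρ = rhoU |I|` of `1` and the target `T ∈ SU(2)` is
within `ρ/(2|I|)` of `Ū(c)`, then `fibreMap U c W = T` for some `W` on the guard with `‖W − U(c)‖ ≤ 2|I|·‖T − Ū(c)‖` (uniform local
inverse of the exp-mean-log fibre map, `rhoU_spec`, transported through the `SU(2) ↔ ℍ` dictionary). -/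
theorem exists_fibreMap_eq [DecidableEq (PBond P j)] (hj : j + 1 ≤ P.m + P.K)
    (U : GaugeField P j (Matrix.specialUnitaryGroup (Fin 2) ℂ)) (c : PBond P (j+1)) (T : Matrix.specialUnitaryGroup (Fin 2) ℂ)
    (hloop : ∀ i, dist1 (loopHol U c i) ≤ rhoU (Fintype.card (Idx P)))
    (hT : mdist T (avgFun expMeanLogSU U c) ≤ rhoU (Fintype.card (Idx P)) / (2 * Fintype.card (Idx P))) :
    ∃ W : Matrix.specialUnitaryGroup (Fin 2) ℂ, W ∈ fibreGuard expMeanLogSU U c ∧ fibreMap expMeanLogSU U c W = T ∧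
      mdist W (axialAvg U c) ≤ 2 * Fintype.card (Idx P) * mdist T (avgFun expMeanLogSU U c) := by
  set n₀ : ℕ := Fintype.card (Idx P) with hn₀_def
  set ρ : ℝ := rhoU n₀ with hρ_def
  have hρ12 : ρ ≤ 1 / 12 := rhoU_le n₀
  have hδ := one_sixth_lt_delta
  set Wstar : Matrix.specialUnitaryGroup (Fin 2) ℂ := axialAvg U c with hW_def
  -- the base point is on the guard and the block average is the fibre map there
  have hguardS : Wstar ∈ fibreGuard expMeanLogSU U c := by
    intro i
    show dist1 (fibreFamily U c (axialAvg U c) i) < _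
    rw [fibreFamily_axialAvg]
    exact (hloop i).trans_lt (by linarith)
  have havg : avgFun expMeanLogSU U c = expMeanLogSU.avg (fibreFamily U c Wstar) * Wstar := by
    rw [avgFun_eq_fibreMap_axialAvg hj, fibreMap_of_mem _ U c hguardS]
  -- quaternion data
  set a : Fin (offCard c) → ℍ := fun k => su2Quat (offHol U c k) with ha_def
  set ustar : ℍ := su2Quat Wstar with hu_def
  set t : ℍ := su2Quat T with ht_def
  have ha : ∀ k, ‖a k‖ = 1 := fun k => norm_su2Quat _
  have hu : ‖ustar‖ = 1 := norm_su2Quat _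
  have ht : ‖t‖ = 1 := norm_su2Quat _
  have hau : ∀ k, ‖a k - ustar‖ ≤ ρ := fun k => by
    set i : Idx P := ((offEquiv c).symm k).1 with hi_def
    have hi : ¬ IsCentral c i := ((offEquiv c).symm k).2
    have hk : offHol U c k = openHol U c i := rfl
    rw [norm_sub_eq_norm_mul_star_sub_one hu]
    show ‖su2Quat (offHol U c k) * star (su2Quat Wstar) - 1‖ ≤ ρ
    rw [hk, ← su2Quat_fibreFamily_off U c Wstar i hi, ← dist1_eq_norm_su2Quat, fibreFamily_axialAvg]
    exact hloop i
  have hkfS : kf a (fun _ => ((n₀ : ℝ))⁻¹) ustar = su2Quat (avgFun expMeanLogSU U c) := by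
    rw [havg, su2Quat_fibreCore U c hguardS]; rfl
  have hdist : ‖t - kf a (fun _ => ((n₀ : ℝ))⁻¹) ustar‖ = mdist T (avgFun expMeanLogSU U c) := by
    rw [hkfS, ht_def, ← mdist_eq]
  -- solve
  obtain ⟨u, hu1, hut, hud⟩ := rhoU_spec (offCard_lt_card c) a ha ustar hu hau t ht (by rw [hdist]; exact hT)
  have hune : u ≠ 0 := by intro h0; rw [h0, norm_zero] at hu1; exact zero_ne_one hu1
  set W : Matrix.specialUnitaryGroup (Fin 2) ℂ := quatToSU2 u with hWdef
  have hWu : su2Quat W = u := by rw [hWdef, su2Quat_quatToSU2 hune, hu1, inv_one, one_smul]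
  -- the solution is on the guard
  have hWguard : W ∈ fibreGuard expMeanLogSU U c := by
    intro i
    by_cases hci : IsCentral c i
    · rw [fibreFamily_of_isCentral U c W i hci, GaugeGroup.dist1_one]; exact expMeanLogSU.δ_pos
    · rw [dist1_eq_norm_su2Quat, su2Quat_fibreFamily_off U c W i hci, hWu, ← offHol_offEquiv U c i hci,
        ← norm_sub_eq_norm_mul_star_sub_one hu1]
      have h1 : ‖a (offEquiv c ⟨i, hci⟩) - u‖ ≤ ρ + 2 * n₀ * (ρ / (2 * n₀)) := by
        calc ‖a (offEquiv c ⟨i, hci⟩) - u‖ = ‖(a (offEquiv c ⟨i, hci⟩) - ustar) + (ustar - u)‖ := by rw [sub_add_sub_cancel]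
          _ ≤ ‖a (offEquiv c ⟨i, hci⟩) - ustar‖ + ‖ustar - u‖ := norm_add_le _ _
          _ ≤ ρ + 2 * n₀ * (ρ / (2 * n₀)) := by
            refine add_le_add (hau _) ?_
            rw [norm_sub_rev]
            exact hud.trans (mul_le_mul_of_nonneg_left (by rw [hdist]; exact hT) (by positivity))
      have hn₀ : (0 : ℝ) < n₀ := by rw [hn₀_def]; exact_mod_cast (Nat.zero_le _).trans_lt (offCard_lt_card c)
      have h2 : ρ + 2 * n₀ * (ρ / (2 * n₀)) = 2 * ρ := by field_simp; ring
      rw [h2] at h1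
      exact h1.trans_lt (by linarith)
  refine ⟨W, hWguard, ?_, ?_⟩
  · -- `fibreMap W = T` through the dictionary
    rw [fibreMap_of_mem _ U c hWguard]
    apply (Function.LeftInverse.injective quatToSU2_su2Quat :
      Function.Injective (su2Quat : Matrix.specialUnitaryGroup (Fin 2) ℂ → ℍ))
    rw [su2Quat_fibreCore U c hWguard, hWu]
    exact hut
  · rw [mdist_eq, hWu, ← hu_def, ← hdist]
    exact hud

/-- **THE EXACT REPAIR OF ALL CENTRAL BONDS** («exactness is free»).  Let `U⋆` be a fine configuration all of whose (0.4) loop variables are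
within `rhoU |I|` of `1`, and `V` a coarse configuration with `‖V(c) − Ū⋆(c)‖ ≤ η ≤ rhoU |I| / (2|I|)` for every coarse bond `c`.  Then
there is a fine configuration `U`, EQUAL TO `U⋆` OFF THE CENTRAL CROSSING BONDS and within `2|I|·η` of it on them, whose (0.4) block
average with the printed exp-mean-log average is EXACTLY `V`.  (The coarse bonds decouple by `IsLocal` — `T4TriangularPushforward.apply_resample_eq`
with FACT (A) of `BlockAveragingHaarAC` — and each is solved by `exists_fibreMap_eq`.) -/
theorem exists_exact_repair (hj : j + 1 ≤ P.m + P.K) (Ustar : GaugeField P j (Matrix.specialUnitaryGroup (Fin 2) ℂ))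
    (V : GaugeField P (j+1) (Matrix.specialUnitaryGroup (Fin 2) ℂ)) {η : ℝ} (hη0 : 0 ≤ η)
    (hloop : ∀ c i, dist1 (loopHol Ustar c i) ≤ rhoU (Fintype.card (Idx P)))
    (hη : η ≤ rhoU (Fintype.card (Idx P)) / (2 * Fintype.card (Idx P)))
    (hV : ∀ c, mdist (V c) (avgFun expMeanLogSU Ustar c) ≤ η) :
    ∃ U : GaugeField P j (Matrix.specialUnitaryGroup (Fin 2) ℂ), avgFun expMeanLogSU U = V ∧
      (∀ b, (¬ ∃ c, centralBond c = b) → U b = Ustar b) ∧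
      ∀ b, mdist (U b) (Ustar b) ≤ 2 * Fintype.card (Idx P) * η := by
  classical
  have hsol : ∀ c, ∃ W : Matrix.specialUnitaryGroup (Fin 2) ℂ, fibreMap expMeanLogSU Ustar c W = V c ∧
      mdist W (axialAvg Ustar c) ≤ 2 * Fintype.card (Idx P) * η := by
    intro c
    obtain ⟨W, -, hWT, hWd⟩ := exists_fibreMap_eq hj Ustar c (V c) (hloop c) ((hV c).trans hη)
    exact ⟨W, hWT, hWd.trans (mul_le_mul_of_nonneg_left (hV c) (by positivity))⟩
  choose W hW hWd using hsol
  set g : PBond P (j+1) → Matrix.specialUnitaryGroup (Fin 2) ℂ := fun c => (pre Ustar c)⁻¹ * W c * (post Ustar c)⁻¹ with hg_def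
  refine ⟨Function.extend centralBond g Ustar, ?_, fun b hb => Function.extend_apply' g Ustar b hb, fun b => ?_⟩
  · funext c
    rw [T4TriangularPushforward.apply_resample_eq (isLocal_avgFun hj expMeanLogSU) (centralBond_injective hj) Ustar g c,
      avgFun_update_centralBond_self hj expMeanLogSU Ustar c (g c), hg_def]
    simp only
    rw [show pre Ustar c * ((pre Ustar c)⁻¹ * W c * (post Ustar c)⁻¹) * post Ustar c = W c by group]
    exact hW c
  · by_cases hb : ∃ c, centralBond c = b
    · obtain ⟨c, rfl⟩ := hb
      rw [(centralBond_injective hj).extend_apply g Ustar c]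
      have hU : Ustar (centralBond c) = (pre Ustar c)⁻¹ * axialAvg Ustar c * (post Ustar c)⁻¹ := by
        rw [axialAvg_eq_pre_mul_mul_post]; group
      rw [hU, hg_def]
      simp only
      rw [mdist_conj]
      exact hWd c
    · rw [Function.extend_apply' g Ustar b hb, mdist_self]
      positivity

end Repair


end Summit.QuantumFields.YangMills.Theorems.MiddleBondRepair

end
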